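import Summits.CriticalPhenomena.PercolationContinuityZ3.Theorems.PercNearOneGluingNoHeavyLowerTailSahiRootSideSep
import HarnessLib

/-!
# One-target sides of two-separations (root outside), II: the dictionary across `{u, v}`

Support file for the Sahi programme (`--supports stmt-CriticalPhenomena-4575`, prover prim-sahi-p2 gen 24).  No definitions, no named
facts, no sorries; standard axioms.  Memo `run/shared/lean/prim/prim-sahi/FROM-prim-sahi-p2-gen24-ONE-TARGET-SIDE.md` §1.

**Setting** (as in gen 12's `…SahiRootSideSep`).  A root side `R ∋ s` and two separating vertices `u, v ∉ R`: on the configurations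
considered no open pair joins `R` to the outside of `R ∪ {u, v}`.  The ROOT-SIDE PAIRS are the pairs meeting `R`
(`F = {e | ∃ y ∈ R, y ∈ e}`; `s(u,v) ∉ F`); write `p ~_F q` for `ω ∩ F ∈ {p ↔ q}` and `Z = {u ↔ v inside Rᶜ}` (a NEAR event: pairs not
meeting `R`).  Deterministic statements:
* `twoCut_conn_rootSide_iff` — for a target `t ∈ R ∪ {u, v}`:
  `s ↔ t ⟺ s ~_F t ∨ (Z ∧ ((s ~_F u ∧ v ~_F t) ∨ (s ~_F v ∧ u ~_F t)))`  (a root-side target is reached inside the root side, possibly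
  after ONE excursion `u ⇝ v` through the outside);
* `twoCut_conn_outside_iff` — for a target `a ∉ R`: `s ↔ a ⟺ (s ~_F u ∧ u ↔ a inside Rᶜ) ∨ (s ~_F v ∧ v ↔ a inside Rᶜ)` (gen 12's
  `SahiRootSide.openConn_iff_exists_rootSide`, unfolded);
* `outside_ports_facts` — `{u ↔ a in Rᶜ} ∩ {v ↔ a in Rᶜ} ⊆ Z`, `Z ∩ {u ↔ a in Rᶜ} ⊆ {v ↔ a in Rᶜ}` and symmetrically.
Set algebra and independence used by the moments (`…OneTargetSideMoments`): `union_inter_union_eq` (two events of the shape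
`B ∪ (M ∩ B')`, `B ⊆ B'`), `nearTarget_inter_eq` (the near target event against such an event splits along the three near cells
`{u ↔ a} ∖ {v ↔ a}`, `{v ↔ a} ∖ {u ↔ a}`, `{u ↔ a} ∩ {v ↔ a}`), `isUpperSet_connF`, `indep_far_near` (events determined by the pairs
meeting `R` are independent of events determined by the other pairs).
-/

noncomputable section

namespace Summit.CriticalPhenomena.PercolationContinuityZ3.Theorems

namespace IncStarOneTargetSide

open MeasureTheory Set Literature.Probability.Percolation Literature.Probability.LatticeModels
open Literature.Probability.Percolation.BlockExploration (exists_openWalk_of_mem_openConnIn)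
open scoped Classical

variable {n : ℕ}

/-! ### Deterministic structure at a two-separator not containing the root -/

section Deterministic

variable {R : Set (Fin n)} {s u v : Fin n} (hs : s ∈ R) {ω : BondConfig (Fin n)}
  (hω : ∀ x ∈ R, ∀ z, z ∉ R → z ≠ u → z ≠ v → s(x, z) ∉ ω)

include hs hω in
/-- **Dictionary for a root-side target.**  On a configuration with no open pair from `R` to the outside of `R ∪ {u,v}`, a target
`t ∈ R ∪ {u, v}` is joined to the root `s ∈ R` iff either `s ~_F t` (open root-side pairs only), or `u ↔ v` inside `Rᶜ` and
(`s ~_F u` and `v ~_F t`) or (`s ~_F v` and `u ~_F t`). [this work] -/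
theorem twoCut_conn_rootSide_iff {t : Fin n} (ht : t ∈ R ∨ t = u ∨ t = v) :
    ω ∈ openConn s t ↔
      ω ∩ {e : Sym2 (Fin n) | ∃ y ∈ R, y ∈ e} ∈ (openConn s t : Set (BondConfig (Fin n))) ∨
        (ω ∈ openConnIn Rᶜ u v ∧
          ((ω ∩ {e : Sym2 (Fin n) | ∃ y ∈ R, y ∈ e} ∈ (openConn s u : Set (BondConfig (Fin n))) ∧
              ω ∩ {e : Sym2 (Fin n) | ∃ y ∈ R, y ∈ e} ∈ (openConn v t : Set (BondConfig (Fin n)))) ∨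
            (ω ∩ {e : Sym2 (Fin n) | ∃ y ∈ R, y ∈ e} ∈ (openConn s v : Set (BondConfig (Fin n))) ∧
              ω ∩ {e : Sym2 (Fin n) | ∃ y ∈ R, y ∈ e} ∈ (openConn u t : Set (BondConfig (Fin n)))))) := by
  set F : Set (Sym2 (Fin n)) := {e : Sym2 (Fin n) | ∃ y ∈ R, y ∈ e} with hF
  have hG₁le : openGraph (ω ∩ F) ≤ openGraph ω := openGraph_mono Set.inter_subset_left
  -- membership in `openConn` is reachability (definitional)
  have conn_iff : ∀ (η : BondConfig (Fin n)) (p q : Fin n), η ∈ (openConn p q : Set (BondConfig (Fin n))) ↔ (openGraph η).Reachable p q :=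
    fun η p q => Iff.rfl
  constructor
  swap
  · rintro (h | ⟨hZ, h⟩)
    · exact SimpleGraph.Reachable.mono hG₁le h
    · obtain ⟨pz, -⟩ := exists_openWalk_of_mem_openConnIn hZ
      have hZ' : (openGraph ω).Reachable u v := ⟨pz⟩
      rcases h with ⟨h₁, h₂⟩ | ⟨h₁, h₂⟩
      · exact ((SimpleGraph.Reachable.mono hG₁le h₁).trans hZ').trans (SimpleGraph.Reachable.mono hG₁le h₂)
      · exact ((SimpleGraph.Reachable.mono hG₁le h₁).trans hZ'.symm).trans (SimpleGraph.Reachable.mono hG₁le h₂)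
  intro hst
  -- the invariant of gen 12, propagated along an open walk from `s`
  let Inv : Fin n → Prop := fun z => (openGraph (ω ∩ F)).Reachable s z ∨
    ∃ x, (x = u ∨ x = v) ∧ (openGraph (ω ∩ F)).Reachable s x ∧
      (ω ∈ openConnIn Rᶜ x z ∨ ∃ y, (y = u ∨ y = v) ∧ ω ∈ openConnIn Rᶜ x y ∧
        (openGraph (ω ∩ F)).Reachable y z)
  have hexit : ∀ {y z : Fin n}, (openGraph (ω ∩ F)).Reachable y z → y ≠ z → z ∉ R → z = u ∨ z = v :=
    fun h hyz hz => SahiRootSide.eq_or_eq_of_rootSide_reachable hω h hyz hz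
  have htwo : ∀ {x y a : Fin n}, (x = u ∨ x = v) → (y = u ∨ y = v) → (a = u ∨ a = v) → y ≠ a → x = y ∨ x = a := by
    rintro x y a (rfl | rfl) (rfl | rfl) (rfl | rfl) hya
    all_goals first | exact Or.inl rfl | exact Or.inr rfl | exact absurd rfl hya
  have step : ∀ a b : Fin n, Inv a → s(a, b) ∈ ω → a ≠ b → Inv b := by
    intro a b hInv hab hne
    by_cases hmeet : a ∈ R ∨ b ∈ R
    · have hadj : (openGraph (ω ∩ F)).Reachable a b := (SahiRootSide.rootSide_adj hab hne hmeet).reachable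
      rcases hInv with h | ⟨x, hx, hsx, h⟩
      · exact Or.inl (h.trans hadj)
      · rcases h with h | ⟨y, hy, hxy, hya⟩
        · have haR : a ∉ R := fun haR => h.2.1 haR
          have hbR : b ∈ R := by rcases hmeet with hm | hm; exacts [absurd hm haR, hm]
          have ha : a = u ∨ a = v := by
            by_contra hcon; push Not at hcon
            have := hω b hbR a haR hcon.1 hcon.2
            rw [Sym2.eq_swap] at this
            exact this hab
          exact Or.inr ⟨x, hx, hsx, Or.inr ⟨a, ha, h, hadj⟩⟩
        · exact Or.inr ⟨x, hx, hsx, Or.inr ⟨y, hy, hxy, hya.trans hadj⟩⟩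
    · push Not at hmeet
      have hab₂ : ω ∈ openConnIn Rᶜ a b := openConnIn_of_adj hmeet.1 hmeet.2 hab hne
      rcases hInv with h | ⟨x, hx, hsx, h⟩
      · have hsa : s ≠ a := fun hsa => hmeet.1 (hsa ▸ hs)
        have ha : a = u ∨ a = v := hexit h hsa hmeet.1
        exact Or.inr ⟨a, ha, h, Or.inl hab₂⟩
      · rcases h with h | ⟨y, hy, hxy, hya⟩
        · exact Or.inr ⟨x, hx, hsx, Or.inl (PlanarDuality.openConnIn_trans h hab₂)⟩
        · by_cases hya' : y = a
          · subst hya'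
            exact Or.inr ⟨x, hx, hsx, Or.inl (PlanarDuality.openConnIn_trans hxy hab₂)⟩
          · have ha : a = u ∨ a = v := hexit hya hya' hmeet.1
            have hsa : (openGraph (ω ∩ F)).Reachable s a := by
              rcases htwo hx hy ha hya' with rfl | rfl
              · exact hsx.trans hya
              · exact hsx
            exact Or.inr ⟨a, ha, hsa, Or.inl hab₂⟩
  have hwalk : ∀ {a b : Fin n} (p : (openGraph ω).Walk a b), b = s → Inv a := by
    intro a b p
    induction p with
    | nil => intro h; subst h; exact Or.inl (SimpleGraph.Reachable.refl _)
    | @cons a' c' b' hadj q ih =>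
      intro hb
      have hc := ih hb
      rw [openGraph_adj] at hadj
      have hadj' : s(c', a') ∈ ω := by rw [Sym2.eq_swap]; exact hadj.1
      exact step c' a' hc hadj' hadj.2.symm
  obtain ⟨p⟩ := hst
  have hInvt : Inv t := hwalk p.reverse rfl
  -- read off the conclusion at `t ∈ R ∪ {u, v}`
  have zcomm : ω ∈ openConnIn Rᶜ v u → ω ∈ openConnIn Rᶜ u v := fun h => by rwa [openConnIn_comm]
  rcases hInvt with h | ⟨x, hx, hsx, h⟩
  · exact Or.inl h
  · rcases h with h | ⟨y, hy, hxy, hyt⟩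
    · -- `t` is reached from `x` inside `Rᶜ`: then `t ∈ {u,v}`
      have htR : t ∉ R := fun htR => h.2.1 htR
      have ht' : t = u ∨ t = v := by rcases ht with ht | ht; exacts [absurd ht htR, ht]
      by_cases hxt : x = t
      · subst hxt; exact Or.inl hsx
      · rcases hx with rfl | rfl <;> rcases ht' with rfl | rfl
        · exact absurd rfl hxt
        · exact Or.inr ⟨h, Or.inl ⟨hsx, SimpleGraph.Reachable.refl _⟩⟩
        · exact Or.inr ⟨zcomm h, Or.inr ⟨hsx, SimpleGraph.Reachable.refl _⟩⟩
        · exact absurd rfl hxt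
    · by_cases hxy' : x = y
      · subst hxy'; exact Or.inl (hsx.trans hyt)
      · rcases hx with rfl | rfl <;> rcases hy with rfl | rfl
        · exact absurd rfl hxy'
        · exact Or.inr ⟨hxy, Or.inl ⟨hsx, hyt⟩⟩
        · exact Or.inr ⟨zcomm hxy, Or.inr ⟨hsx, hyt⟩⟩
        · exact absurd rfl hxy'

include hs hω in
/-- **Dictionary for an outside target** (gen 12, unfolded): for `a ∉ R`,
`s ↔ a ⟺ (s ~_F u ∧ u ↔ a inside Rᶜ) ∨ (s ~_F v ∧ v ↔ a inside Rᶜ)`. [this work] -/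
theorem twoCut_conn_outside_iff {a : Fin n} (ha : a ∉ R) :
    ω ∈ openConn s a ↔
      (ω ∩ {e : Sym2 (Fin n) | ∃ y ∈ R, y ∈ e} ∈ (openConn s u : Set (BondConfig (Fin n))) ∧ ω ∈ openConnIn Rᶜ u a) ∨
        (ω ∩ {e : Sym2 (Fin n) | ∃ y ∈ R, y ∈ e} ∈ (openConn s v : Set (BondConfig (Fin n))) ∧ ω ∈ openConnIn Rᶜ v a) := by
  rw [SahiRootSide.openConn_iff_exists_rootSide hs hω ha]
  constructor
  · rintro ⟨x, hx, h₁, h₂⟩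
    rcases hx with rfl | rfl
    · exact Or.inl ⟨h₁, h₂⟩
    · exact Or.inr ⟨h₁, h₂⟩
  · rintro (⟨h₁, h₂⟩ | ⟨h₁, h₂⟩)
    · exact ⟨u, Or.inl rfl, h₁, h₂⟩
    · exact ⟨v, Or.inr rfl, h₁, h₂⟩

end Deterministic

/-- **The three near ports.**  `{u ↔ a in S} ∩ {v ↔ a in S} ⊆ {u ↔ v in S}`, `{u ↔ v in S} ∩ {u ↔ a in S} ⊆ {v ↔ a in S}` and
`{u ↔ v in S} ∩ {v ↔ a in S} ⊆ {u ↔ a in S}`. [folklore] -/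
theorem outside_ports_facts (S : Set (Fin n)) (u v a : Fin n) (ω : BondConfig (Fin n)) :
    (ω ∈ openConnIn S u a → ω ∈ openConnIn S v a → ω ∈ openConnIn S u v) ∧
      (ω ∈ openConnIn S u v → ω ∈ openConnIn S u a → ω ∈ openConnIn S v a) ∧
      (ω ∈ openConnIn S u v → ω ∈ openConnIn S v a → ω ∈ openConnIn S u a) := by
  have cm : ∀ {p q : Fin n}, ω ∈ openConnIn S p q → ω ∈ openConnIn S q p := fun h => by rwa [openConnIn_comm]
  exact ⟨fun h₁ h₂ => PlanarDuality.openConnIn_trans h₁ (cm h₂), fun h₁ h₂ => PlanarDuality.openConnIn_trans (cm h₁) h₂,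
    fun h₁ h₂ => PlanarDuality.openConnIn_trans h₁ h₂⟩


/-! ### Set algebra for events of the shape `B ∪ (M ∩ B')` -/

/-- Two events `B ∪ (M ∩ B')`, `C ∪ (M ∩ C')` with `B ⊆ B'`, `C ⊆ C'` intersect in `(B ∩ C) ∪ (M ∩ (B' ∩ C'))` — again of the same shape.
[folklore] -/
theorem union_inter_union_eq {α : Type*} {B B' C C' : Set α} (M : Set α) (hB : B ⊆ B') (hC : C ⊆ C') :
    (B ∪ (M ∩ B')) ∩ (C ∪ (M ∩ C')) = (B ∩ C) ∪ (M ∩ (B' ∩ C')) := by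
  ext ω
  simp only [Set.mem_inter_iff, Set.mem_union]
  constructor
  · rintro ⟨hb | ⟨hM, hb'⟩, hc | ⟨hM', hc'⟩⟩
    · exact Or.inl ⟨hb, hc⟩
    · exact Or.inr ⟨hM', hB hb, hc'⟩
    · exact Or.inr ⟨hM, hb', hC hc⟩
    · exact Or.inr ⟨hM, hb', hc'⟩
  · rintro (⟨hb, hc⟩ | ⟨hM, hb', hc'⟩)
    · exact ⟨Or.inl hb, Or.inl hc⟩
    · exact ⟨Or.inr ⟨hM, hb'⟩, Or.inr ⟨hM, hc'⟩⟩

/-- `B ∪ (M ∩ B') = B ⊔ (M ∩ (B' ∖ B))` (disjoint form). [folklore] -/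
theorem union_inter_eq_disjoint {α : Type*} (B B' M : Set α) :
    B ∪ (M ∩ B') = B ∪ (M ∩ (B' \ B)) ∧ Disjoint B (M ∩ (B' \ B)) := by
  refine ⟨?_, Set.disjoint_left.2 fun ω hb h => h.2.2 hb⟩
  ext ω
  simp only [Set.mem_union, Set.mem_inter_iff, Set.mem_sdiff]
  constructor
  · rintro (hb | ⟨hM, hb'⟩)
    · exact Or.inl hb
    · by_cases hb : ω ∈ B
      · exact Or.inl hb
      · exact Or.inr ⟨hM, hb', hb⟩
  · rintro (hb | ⟨hM, hb', -⟩)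
    · exact Or.inl hb
    · exact Or.inr ⟨hM, hb'⟩

/-- **Probability of `B ∪ (M ∩ B')`.**  If `B ⊆ B'` and `M` is independent of `B' ∖ B`, then
`P(B ∪ (M ∩ B')) = (1 − P(M))·P(B) + P(M)·P(B')`. [folklore] -/
theorem real_union_inter_eq {μ : Measure (BondConfig (Fin n))} [IsProbabilityMeasure μ] {B B' M : Set (BondConfig (Fin n))}
    (hB : B ⊆ B') (hind : μ.real (M ∩ (B' \ B)) = μ.real M * μ.real (B' \ B)) :
    μ.real (B ∪ (M ∩ B')) = (1 - μ.real M) * μ.real B + μ.real M * μ.real B' := by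
  have hm : ∀ X : Set (BondConfig (Fin n)), MeasurableSet X := fun _ => MeasurableSet.of_discrete
  obtain ⟨h1, h2⟩ := union_inter_eq_disjoint B B' M
  have hdiff : μ.real (B' \ B) = μ.real B' - μ.real B := by
    have h := measureReal_inter_add_sdiff (μ := μ) (s := B') (hm B)
    rw [Set.inter_eq_self_of_subset_right hB] at h
    linarith
  rw [h1, measureReal_union h2 (hm _), hind, hdiff]
  ring

/-- **The near target against a two-level event.**  With `Au = {u ↔ a}`, `Av = {v ↔ a}`, `Z = {u ↔ v}` (inside `Rᶜ`) satisfying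
`Au ∩ Av ⊆ Z`, `Z ∩ Au ⊆ Av`, `Z ∩ Av ⊆ Au`, far ports `Xu, Xv` and a two-level far event `T₀ ⊆ T₁`:
`((Au ∩ Xu) ∪ (Av ∩ Xv)) ∩ (T₀ ∪ (Z ∩ T₁))` is the disjoint union of `(Au ∖ Av) ∩ (Xu ∩ T₀)`, `(Av ∖ Au) ∩ (Xv ∩ T₀)` and
`(Au ∩ Av) ∩ ((Xu ∪ Xv) ∩ T₁)`. [this work] -/
theorem nearTarget_inter_eq {α : Type*} {Au Av Z Xu Xv T₀ T₁ : Set α}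
    (h1 : Au ∩ Av ⊆ Z) (h2 : Z ∩ Au ⊆ Av) (h3 : Z ∩ Av ⊆ Au) (hT : T₀ ⊆ T₁) :
    ((Au ∩ Xu) ∪ (Av ∩ Xv)) ∩ (T₀ ∪ (Z ∩ T₁))
      = (((Au \ Av) ∩ (Xu ∩ T₀)) ∪ ((Av \ Au) ∩ (Xv ∩ T₀))) ∪ ((Au ∩ Av) ∩ ((Xu ∪ Xv) ∩ T₁)) := by
  ext ω
  simp only [Set.mem_inter_iff, Set.mem_union, Set.mem_sdiff]
  constructor
  · rintro ⟨hA, hTω⟩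
    by_cases hu : ω ∈ Au <;> by_cases hv : ω ∈ Av
    · have hT1 : ω ∈ T₁ := by
        rcases hTω with h | ⟨-, h⟩
        · exact hT h
        · exact h
      have hX : ω ∈ Xu ∨ ω ∈ Xv := by
        rcases hA with ⟨-, h⟩ | ⟨-, h⟩
        · exact Or.inl h
        · exact Or.inr h
      exact Or.inr ⟨⟨hu, hv⟩, hX, hT1⟩
    · have hZ : ω ∉ Z := fun hZ => hv (h2 ⟨hZ, hu⟩)
      have hT0 : ω ∈ T₀ := by
        rcases hTω with h | ⟨h, -⟩
        · exact h
        · exact absurd h hZ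
      have hX : ω ∈ Xu := by
        rcases hA with ⟨-, h⟩ | ⟨h, -⟩
        · exact h
        · exact absurd h hv
      exact Or.inl (Or.inl ⟨⟨hu, hv⟩, hX, hT0⟩)
    · have hZ : ω ∉ Z := fun hZ => hu (h3 ⟨hZ, hv⟩)
      have hT0 : ω ∈ T₀ := by
        rcases hTω with h | ⟨h, -⟩
        · exact h
        · exact absurd h hZ
      have hX : ω ∈ Xv := by
        rcases hA with ⟨h, -⟩ | ⟨-, h⟩
        · exact absurd h hu
        · exact h
      exact Or.inl (Or.inr ⟨⟨hv, hu⟩, hX, hT0⟩)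
    · rcases hA with ⟨h, -⟩ | ⟨h, -⟩
      · exact absurd h hu
      · exact absurd h hv
  · rintro ((⟨⟨hu, -⟩, hX, hT0⟩ | ⟨⟨hv, -⟩, hX, hT0⟩) | ⟨⟨hu, hv⟩, hX, hT1⟩)
    · exact ⟨Or.inl ⟨hu, hX⟩, Or.inl hT0⟩
    · exact ⟨Or.inr ⟨hv, hX⟩, Or.inl hT0⟩
    · have hZ : ω ∈ Z := h1 ⟨hu, hv⟩
      rcases hX with hX | hX
      · exact ⟨Or.inl ⟨hu, hX⟩, Or.inr ⟨hZ, hT1⟩⟩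
      · exact ⟨Or.inr ⟨hv, hX⟩, Or.inr ⟨hZ, hT1⟩⟩

/-- The three pieces of `nearTarget_inter_eq` are pairwise disjoint (they live on the disjoint near cells). [this work] -/
theorem nearTarget_pieces_disjoint {α : Type*} (Au Av P Q S : Set α) :
    Disjoint ((Au \ Av) ∩ P) ((Av \ Au) ∩ Q) ∧ Disjoint (((Au \ Av) ∩ P) ∪ ((Av \ Au) ∩ Q)) ((Au ∩ Av) ∩ S) := by
  refine ⟨Set.disjoint_left.2 fun ω h h' => h'.1.2 h.1.1, Set.disjoint_left.2 fun ω h h' => ?_⟩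
  rcases h with h | h
  · exact h.1.2 h'.1.2
  · exact h.1.2 h'.1.1

/-! ### Monotonicity, locality and independence -/

/-- Root-side connection events `{ω | ω ∩ F ∈ {p ↔ q}}` are increasing. [folklore] -/
theorem isUpperSet_connF (F : Set (Sym2 (Fin n))) (p q : Fin n) :
    IsUpperSet {ω : BondConfig (Fin n) | ω ∩ F ∈ (openConn p q : Set (BondConfig (Fin n)))} :=
  fun _ _ hle h => isUpperSet_openConn p q (Set.inter_subset_inter_left F hle) h

/-- Events determined by a set of pairs are closed under `∪` and `∖` (plumbing; `∩` is `DeterminedBy.inter`). [folklore] -/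
theorem determinedBy_union_sdiff {A B : Set (BondConfig (Fin n))} {K : Set (Sym2 (Fin n))} (hA : DeterminedBy A K)
    (hB : DeterminedBy B K) : DeterminedBy (A ∪ B) K ∧ DeterminedBy (A \ B) K := by
  rw [determinedBy_iff] at hA hB
  refine ⟨(determinedBy_iff _ _).2 fun ω ω' h => ?_, (determinedBy_iff _ _).2 fun ω ω' h => ?_⟩
  · rw [Set.mem_union, Set.mem_union, hA ω ω' h, hB ω ω' h]
  · rw [Set.mem_sdiff, Set.mem_sdiff, hA ω ω' h, hB ω ω' h]

/-- **Far and near are independent.**  An event determined by the pairs meeting `R` and an event determined by the other pairs are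
independent under every `prodBernoulli w` (disjoint coordinate sets). [this work] -/
theorem indep_far_near (w : Sym2 (Fin n) → unitInterval) (R : Set (Fin n)) {B A : Set (BondConfig (Fin n))}
    (hB : DeterminedBy B {e : Sym2 (Fin n) | ∃ y ∈ R, y ∈ e}) (hA : DeterminedBy A {e : Sym2 (Fin n) | ∃ y ∈ R, y ∈ e}ᶜ) :
    (prodBernoulli w).real (B ∩ A) = (prodBernoulli w).real B * (prodBernoulli w).real A := by
  set F : Set (Sym2 (Fin n)) := {e : Sym2 (Fin n) | ∃ y ∈ R, y ∈ e} with hF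
  set FF : Finset (Sym2 (Fin n)) := Finset.univ.filter (fun e : Sym2 (Fin n) => ∃ y ∈ R, y ∈ e) with hFFdef
  have hFF : (↑FF : Set (Sym2 (Fin n))) = F := by ext e; simp [hFFdef, hF]
  have hFFc : (↑FFᶜ : Set (Sym2 (Fin n))) = Fᶜ := by rw [Finset.coe_compl, hFF]
  have hB' : DeterminedBy B ↑FF := by rw [hFF]; exact hB
  have hA' : DeterminedBy A ↑FFᶜ := by rw [hFFc]; exact hA
  exact prodBernoulli_real_inter_of_determinedBy_disjoint w disjoint_compl_right hB' hA'
    MeasurableSet.of_discrete MeasurableSet.of_discrete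

/-- Symmetric form of `indep_far_near` (near event first). [this work] -/
theorem indep_near_far (w : Sym2 (Fin n) → unitInterval) (R : Set (Fin n)) {A B : Set (BondConfig (Fin n))}
    (hA : DeterminedBy A {e : Sym2 (Fin n) | ∃ y ∈ R, y ∈ e}ᶜ) (hB : DeterminedBy B {e : Sym2 (Fin n) | ∃ y ∈ R, y ∈ e}) :
    (prodBernoulli w).real (A ∩ B) = (prodBernoulli w).real A * (prodBernoulli w).real B := by
  rw [Set.inter_comm, indep_far_near w R hB hA, mul_comm]

/-! ### Harris on each side -/

/-- **Near Harris constraint**: `P(Z)·(P(Au ∖ Av) + P(Av ∖ Au) + P(Au ∩ Av)) ≤ P(Au ∩ Av)` for `Au = {u ↔ a in S}`, `Av = {v ↔ a in S}`,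
`Z = {u ↔ v in S}` — Harris for the increasing events `Au ∪ Av` and `Z`, with `(Au ∪ Av) ∩ Z = Au ∩ Av`. [this work] -/
theorem near_harris (w : Sym2 (Fin n) → unitInterval) (S : Set (Fin n)) (u v a : Fin n) :
    (prodBernoulli w).real (openConnIn S u v)
        * ((prodBernoulli w).real (openConnIn S u a \ openConnIn S v a) + (prodBernoulli w).real (openConnIn S v a \ openConnIn S u a)
          + (prodBernoulli w).real (openConnIn S u a ∩ openConnIn S v a))
      ≤ (prodBernoulli w).real (openConnIn S u a ∩ openConnIn S v a) := by
  have hm : ∀ X : Set (BondConfig (Fin n)), MeasurableSet X := fun _ => MeasurableSet.of_discrete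
  set Au : Set (BondConfig (Fin n)) := openConnIn S u a
  set Av : Set (BondConfig (Fin n)) := openConnIn S v a
  set Z : Set (BondConfig (Fin n)) := openConnIn S u v
  have hsplit : (prodBernoulli w).real (Au ∪ Av)
      = (prodBernoulli w).real (Au \ Av) + (prodBernoulli w).real (Av \ Au) + (prodBernoulli w).real (Au ∩ Av) := by
    have hset : Au ∪ Av = ((Au \ Av) ∪ (Av \ Au)) ∪ (Au ∩ Av) := by
      ext ω; simp only [Set.mem_union, Set.mem_sdiff, Set.mem_inter_iff]; tauto
    rw [hset, measureReal_union ?_ (hm _), measureReal_union ?_ (hm _)]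
    · exact Set.disjoint_left.2 fun ω h h' => h.2 h'.1
    · exact Set.disjoint_left.2 fun ω h h' => by
        rcases h with h | h
        · exact h.2 h'.2
        · exact h.2 h'.1
  have hcap : (Au ∪ Av) ∩ Z = Au ∩ Av := by
    ext ω
    simp only [Set.mem_inter_iff, Set.mem_union]
    constructor
    · rintro ⟨hu | hv, hZ⟩
      · exact ⟨hu, (outside_ports_facts S u v a ω).2.1 hZ hu⟩
      · exact ⟨(outside_ports_facts S u v a ω).2.2 hZ hv, hv⟩
    · rintro ⟨hu, hv⟩
      exact ⟨Or.inl hu, (outside_ports_facts S u v a ω).1 hu hv⟩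
  have h := prodBernoulli_harris w ((isUpperSet_openConnIn S u a).union (isUpperSet_openConnIn S v a)) (isUpperSet_openConnIn S u v)
    (hm (Au ∪ Av)) (hm Z)
  rw [hcap, hsplit] at h
  linarith [h]

/-- **Far Harris constraint**: `P(Xu ∪ Xv)·P(T) ≤ P((Xu ∪ Xv) ∩ T)` for the root-side ports `Xu = {s ~_F u}`, `Xv = {s ~_F v}` and any
increasing `T`. [this work] -/
theorem far_harris (w : Sym2 (Fin n) → unitInterval) (F : Set (Sym2 (Fin n))) (s u v : Fin n) {T : Set (BondConfig (Fin n))}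
    (hT : IsUpperSet T) :
    (prodBernoulli w).real ({ω : BondConfig (Fin n) | ω ∩ F ∈ (openConn s u : Set (BondConfig (Fin n)))}
          ∪ {ω : BondConfig (Fin n) | ω ∩ F ∈ (openConn s v : Set (BondConfig (Fin n)))}) * (prodBernoulli w).real T
      ≤ (prodBernoulli w).real (({ω : BondConfig (Fin n) | ω ∩ F ∈ (openConn s u : Set (BondConfig (Fin n)))}
          ∪ {ω : BondConfig (Fin n) | ω ∩ F ∈ (openConn s v : Set (BondConfig (Fin n)))}) ∩ T) :=
  prodBernoulli_harris w ((isUpperSet_connF F s u).union (isUpperSet_connF F s v)) hT MeasurableSet.of_discrete MeasurableSet.of_discrete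

end IncStarOneTargetSide

end Summit.CriticalPhenomena.PercolationContinuityZ3.Theorems
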